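import Summits.QuantumFields.YangMills.Theorems.UnitScaleTiltProp7PcolPin
import Summits.QuantumFields.YangMills.Theorems.UnitScaleTiltProp7MassiveSolutionGradientSupOfRegPr
import Summits.QuantumFields.YangMills.Theorems.UnitScaleTiltProp7CurvedMemberGradientRowPin
import Summits.QuantumFields.YangMills.Theorems.UnitScaleTiltProp7RSEqPrintProjectorOfLift
import HarnessLib

/-!
# Route `UnitScaleTilt`, crux K1 «MinimiserStabilityRegPr» (stmt-QuantumFields-19200), EX face S46∕S47, row `hPcol` — **PIN-B: hPcol AT ONE MEMBER WITH EVERY (L3′b) LETTER DISCHARGED AND A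
# MEMBER-FREE CONSTANT** — PIN-A ✓`Prop7PcolPin.hPcol_pin` with its three sup letters inhabited at ★p1's pin `c₁ := c₀·(L³)^{K−n}` under ONE column window `μ(am)`:
# `hcol` by V5b ✓`Prop7ComplementaryProjectorPointwiseDecayClosed.hcol_of_massiveColumn_decay` (V4 ✓p762742 read at one rate), `hGsup`∕`hT1` by px12 g16's ✓p765745
# `Prop7MassiveSolutionGradientSupOfRegPr.hGsup_of_regPr`∕`hT1_of_regPr` (T1 CLOSED over px19 g13's ✓p765411), the window rows by routeR-w4 ✓`window_delta`∕`window_win`, and the three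
# constants REWRITTEN LEAF BY LEAF into numbers of `(am, ε₀)` and the two universal atoms (px10 g12's ✓`unitA_pin`∕`unitU1_pin`∕`unitU3_pin` + three new leaves for px12's `√(c₀ℓ³)`-arranged units).

Cell `ym3-torus` (HUMAN RULING D-0037; rung R3 = SU(2) YM₃ on T³ — NOT d = 4, NOT infinite volume, NOT a mass gap, NOT Clay).  Width seat `ym3-torus-px5` (gen 13); CHAIR WORD №9 (ii)
«hPcol BOOK = PIN-A → PIN-B → AllMembers → S47».  THEOREMS ONLY (0 `def`, 0 `sorry`); `--supports stmt-QuantumFields-19200 --as helper`; count-neutral.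

WHAT IS PROVED (ns `Summit.QuantumFields.YangMills.Theorems.Prop7PcolMember`).
* §1 three leaf identities at the pin (pure real algebra, `Real.sqrt_mul`∕`Real.mul_self_sqrt`, `(L³)^{K−n} = (L^{K−n})³`): `unitP1_pin` (px12's penalty-in-value unit `= am·(5∕4)√2·√(25∕8)·(8√(max 2 (16∕am)))²`),
  `unitP3_pin` (the same unit with `e^{3μ}` inside, px12's `M_p`), `unitP2_pin` (px12's `B₂`-type unit: `√(3³∕(c₀ℓ³)·8)·√(c₀(L^d)^{K−n}) = √216`).
* §2 ★★★ `hPcol_member` — for `n < K`, `U₀ ∈ 𝔘_k(ε₀)` (`10⁷L³ε₀ ≤ 1`), `Q″` with `hseq`, the Lift letters `hRS hker`, the LOD data at the pinned weight and mass `0 < am` (`ι hι T hT G hAG hGA`), `0 ≤ a′`,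
  the ROOM letter `hroom : 2·(12·L^{K−n} + 5) ≤ sitesPerDir 0` (T1's, CHAIR WORD №1 class — the small members go by px12 g16's cover road `…MassiveSolutionOfCover`) and `hsmall : C_g·(48ε₀(6√2√10 + 6√2)) ≤ 1∕2`:
  `Σ_x ‖toL2S⁻¹(G′ᴾ_{a′}(R_S(D*_{U₀}(toL2(δ_bd ⊗ E)))))(x)‖ ≤ 4√2·(R₁⋆(am, ε₀)·(5·(1 + C_src⋆(am)·B_v⋆(am))))·‖E‖` with the three constants CLOSED (no `K`, `n`, `c₀`, `c₁`, `|T³|`; atoms `am`, `ε₀`,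
  `exists_curved_localGradient.choose`, `norm_bgOfCfg_axialT_sub_le.choose`) — the body of the AllMembers ∃-package for the roomy members.
* §3 ★★★ `hPcol_member_of_lift` — the same with the FAMILIES OF RECORD DISCHARGED (px10 g12's ✓p765417 recipe): `Q″`∕`hseq`∕`hker` from ✓`exists_intertwiner_of_regPr`, `hRS` from
  ✓`RS_eq_projR_of_lift` under the face's Lift antecedent VERBATIM (`10¹²L³ε₀ ≤ 1`), `ι` by `rfl`, `T := (ι∘Q″)†`, `G` by ✓`exists_massive_inverse` — displayed ONLY `RegPr`, the window, `hLift`, `0 ≤ a′`,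
  `hroom`, `hsmall`; constant = §2's.
HYP-SAT (★★OWNER RULING №42): `hreg` + `hε7` (EX class); LOD letters at the pin (⟸ `rfl`∕adjoint∕✓`exists_massive_inverse`); `hRS hker` (⟸ ✓`RS_eq_projR_of_lift` under the face's Lift antecedent);
`hroom` true for members with `L^{F.m+n}` large (the rest by the cover road); `hsmall` = print's smallness of `ε₀` vs the universal `C_g` (K-free); conclusion non-vacuous; no `Prop` placeholder.
HONEST SCOPE.  Plumbing + leaf algebra over landed rows; nothing of V4∕V5b∕T1∕P3v themselves, the cover road, the AllMembers package, `hPcol` at the display index, the nine other print rows,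
`hThm2S`, EX or the crux is proved here; the Yang–Mills mass gap is NOT proved.

References: T. Bałaban, CMP **99** (1985) 389–434 [Balaban1985BackgroundPropagators] ((3.11) p.392, (3.21)–(3.25) p.394, Thm 3.1 (3.42)∕(3.46) pp.397–398, (3.49) p.399);
CMP **102** (1985) 277–309 [Balaban1985Variational] ((138)–(139) p.299); CMP **116** (1988) 1–22 [Balaban1988RG2Cluster] ((2.7) p.13).
-/

set_option autoImplicit false

noncomputable section

open scoped BigOperators Matrix.Norms.L2Operator InnerProductSpace ComplexConjugate Matrix

namespace Summit.QuantumFields.YangMills.Theorems.Prop7PcolMember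

open Literature.MathematicalPhysics.QuantumFieldTheory.Balaban1983to89
open Literature.MathematicalPhysics.QuantumFieldTheory.Balaban1983to89.T3ContinuumYM3Torus
open T4Continuum BlockAveraging
open BlockAveraging (Idx)
open B7Prop1Explicit (disp)
open B5Eq118OneStroke (iterBlockOf)
open B15DeterminingSets (embIter)
open B10Eq27TorusAxialLog (holT transl)
open B7TransferAnalyticMean (meanCLM)
open B4Sect5Torus (TSite)
open B9SectCLatticeCarrier (Bond)
open B9Eq311L2Pairing (WL2)
open B11Eq103H1Complex (SiteL2K BondL2K projR)
open Summit.QuantumFields.YangMills.Theorems.Prop8Chart (emlIterU)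
open T3SectALandauChart (eta eta_pos bgUnits)
open T3PrintedRegularMinimiser (RegPr)
open T3PrintedRegularOrbits (sites_eq)
open T3LevelShift (siteShift)
open Summit.QuantumFields.YangMills.Theorems.Prop7SectET3Transport (periodsT3 siteEquiv bondEquiv)
open Summit.QuantumFields.YangMills.Theorems.Prop7SectET3HilbertLetters (W₂ toL2 toL2S DL2 DstarL2 covLapSite)
open Summit.QuantumFields.YangMills.Theorems.Prop7SectET3GaugeProjector (NS RS)
open Summit.QuantumFields.YangMills.Theorems.Prop7SectET3DeltaPiPInv (kerDProj GprimeP)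
open Summit.QuantumFields.YangMills.Theorems.Prop7LODSlotK2WindowLetters (window_delta window_win)
open Summit.QuantumFields.YangMills.Theorems.Prop7ComplementaryProjectorPointwiseDecayClosed (hcol_of_massiveColumn_decay)
open Summit.QuantumFields.YangMills.Theorems.Prop7MassiveSolutionGradientSupOfRegPr (hGsup_of_regPr hT1_of_regPr)
open Summit.QuantumFields.YangMills.Theorems.Prop7CurvedMemberGradientRowPin (unitA_pin unitU1_pin unitU3_pin)
open Summit.QuantumFields.YangMills.Theorems.Prop7CurvedMemberLocalGradient (exists_curved_localGradient)
open Summit.QuantumFields.YangMills.Theorems.AxialGaugeChartGlue (norm_bgOfCfg_axialT_sub_le)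
open Summit.QuantumFields.YangMills.Theorems.Prop7PcolPin (hPcol_pin)
open Summit.QuantumFields.YangMills.Theorems.Prop7NSIntertwinerOfRecord (exists_intertwiner_of_regPr)
open Summit.QuantumFields.YangMills.Theorems.Prop7RSEqPrintProjectorOfLift (RS_eq_projR_of_lift)
open Summit.QuantumFields.YangMills.Theorems.Prop7MassivePropagatorCoercive (exists_massive_inverse)

/-! ## §1 Three more leaves at the pin `c₁ = c₀·(L³)^{K−n}` -/

section Pin

variable (F : T3Family) {n K : ℕ} {c₀ : ℝ}

/-- **(P1) px12's PENALTY-IN-VALUE UNIT AT THE PIN**: `(am·(5∕4)√(2c₁)ℓ⁻³∕c₀·√(25∕8·c₁ℓ⁻³∕c₀))·(8√M)²·(√(c₀ℓ³)·1) = am·(5∕4)√2·√(25∕8)·(8√(max 2 (16∕am)))²` (`√(2c₁)·√(c₀ℓ³) = √2·c₀ℓ³` at the pin).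
[cite: Balaban1985BackgroundPropagators, (3.24) p.394, Thm 3.1 (3.42) p.397] -/
theorem unitP1_pin (hc₀ : 0 < c₀) {am : ℝ} (ham : 0 < am) :
    (am * ((5 / 4) * Real.sqrt (2 * (c₀ * ((F.L : ℝ) ^ 3) ^ (K - n))) * ((((F.P K).L : ℝ) ^ (F.P K).d) ^ (K - n))⁻¹ / c₀) * Real.sqrt ((25 / 8) * ((c₀ * ((F.L : ℝ) ^ 3) ^ (K - n)) * ((((F.P K).L : ℝ) ^ (F.P K).d) ^ (K - n))⁻¹ / c₀))) * ((8 * Real.sqrt (max 2 (16 * c₀ * ((F.L : ℝ) ^ (K - n)) ^ 3 / (am * (c₀ * ((F.L : ℝ) ^ 3) ^ (K - n))))) ^ 2) * (Real.sqrt (c₀ * ((((F.P K).L : ℝ) ^ (F.P K).d) ^ (K - n))) * 1)) = am * ((5 / 4) * Real.sqrt 2) * Real.sqrt (25 / 8) * (8 * Real.sqrt (max 2 (16 / am)) ^ 2) := by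
  have hL : (0 : ℝ) < F.L := by have := F.hL.2; exact_mod_cast (by omega : 0 < F.L)
  have hPL : ((F.P K).L : ℝ) = (F.L : ℝ) := by norm_cast
  have hX : ((((F.P K).L : ℝ) ^ (F.P K).d) ^ (K - n)) = ((F.L : ℝ) ^ 3) ^ (K - n) := by rw [hPL, T3Family.P_d]
  have h3 : ((F.L : ℝ) ^ 3) ^ (K - n) ≠ 0 := by positivity
  have hC1 : 0 < c₀ * ((F.L : ℝ) ^ 3) ^ (K - n) := by positivity
  have hS : (25 / 8 : ℝ) * ((c₀ * ((F.L : ℝ) ^ 3) ^ (K - n)) * ((((F.P K).L : ℝ) ^ (F.P K).d) ^ (K - n))⁻¹ / c₀) = 25 / 8 := by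
    rw [hX]; field_simp
  have hM : 16 * c₀ * ((F.L : ℝ) ^ (K - n)) ^ 3 / (am * (c₀ * ((F.L : ℝ) ^ 3) ^ (K - n))) = 16 / am := by
    rw [← pow_mul, ← pow_mul, mul_comm (K - n) 3]
    have h3' : (F.L : ℝ) ^ (3 * (K - n)) ≠ 0 := by positivity
    field_simp
  have hs2 : Real.sqrt (2 * (c₀ * ((F.L : ℝ) ^ 3) ^ (K - n))) = Real.sqrt 2 * Real.sqrt (c₀ * ((F.L : ℝ) ^ 3) ^ (K - n)) := Real.sqrt_mul (by norm_num) _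
  have hr : Real.sqrt (c₀ * ((F.L : ℝ) ^ 3) ^ (K - n)) * Real.sqrt (c₀ * ((F.L : ℝ) ^ 3) ^ (K - n)) = c₀ * ((F.L : ℝ) ^ 3) ^ (K - n) := Real.mul_self_sqrt hC1.le
  rw [hS, hM, hX, hs2]
  refine Eq.trans (b := am * ((5 / 4) * Real.sqrt 2) * Real.sqrt (25 / 8) * (8 * Real.sqrt (max 2 (16 / am)) ^ 2)
      * ((Real.sqrt (c₀ * ((F.L : ℝ) ^ 3) ^ (K - n)) * Real.sqrt (c₀ * ((F.L : ℝ) ^ 3) ^ (K - n))) * (((F.L : ℝ) ^ 3) ^ (K - n))⁻¹ / c₀)) (by ring) ?_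
  rw [hr]; field_simp

/-- **(P3) THE SAME UNIT WITH `e^{3μ}` INSIDE** (px12's `M_p` arrangement). [cite: Balaban1985BackgroundPropagators, (3.24) p.394] -/
theorem unitP3_pin (hc₀ : 0 < c₀) {am : ℝ} (ham : 0 < am) (μ : ℝ) :
    am * ((5 / 4) * Real.sqrt (2 * (c₀ * ((F.L : ℝ) ^ 3) ^ (K - n))) * ((((F.P K).L : ℝ) ^ (F.P K).d) ^ (K - n))⁻¹ / c₀) * Real.sqrt ((25 / 8) * ((c₀ * ((F.L : ℝ) ^ 3) ^ (K - n)) * ((((F.P K).L : ℝ) ^ (F.P K).d) ^ (K - n))⁻¹ / c₀)) * (Real.exp (3 * μ) * (8 * Real.sqrt (max 2 (16 * c₀ * ((F.L : ℝ) ^ (K - n)) ^ 3 / (am * (c₀ * ((F.L : ℝ) ^ 3) ^ (K - n))))) ^ 2) * (Real.sqrt (c₀ * ((((F.P K).L : ℝ) ^ (F.P K).d) ^ (K - n))) * 1)) = am * ((5 / 4) * Real.sqrt 2) * Real.sqrt (25 / 8) * (Real.exp (3 * μ) * (8 * Real.sqrt (max 2 (16 / am)) ^ 2)) := by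
  have hL : (0 : ℝ) < F.L := by have := F.hL.2; exact_mod_cast (by omega : 0 < F.L)
  have hPL : ((F.P K).L : ℝ) = (F.L : ℝ) := by norm_cast
  have hX : ((((F.P K).L : ℝ) ^ (F.P K).d) ^ (K - n)) = ((F.L : ℝ) ^ 3) ^ (K - n) := by rw [hPL, T3Family.P_d]
  have h3 : ((F.L : ℝ) ^ 3) ^ (K - n) ≠ 0 := by positivity
  have hC1 : 0 < c₀ * ((F.L : ℝ) ^ 3) ^ (K - n) := by positivity
  have hS : (25 / 8 : ℝ) * ((c₀ * ((F.L : ℝ) ^ 3) ^ (K - n)) * ((((F.P K).L : ℝ) ^ (F.P K).d) ^ (K - n))⁻¹ / c₀) = 25 / 8 := by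
    rw [hX]; field_simp
  have hM : 16 * c₀ * ((F.L : ℝ) ^ (K - n)) ^ 3 / (am * (c₀ * ((F.L : ℝ) ^ 3) ^ (K - n))) = 16 / am := by
    rw [← pow_mul, ← pow_mul, mul_comm (K - n) 3]
    have h3' : (F.L : ℝ) ^ (3 * (K - n)) ≠ 0 := by positivity
    field_simp
  have hs2 : Real.sqrt (2 * (c₀ * ((F.L : ℝ) ^ 3) ^ (K - n))) = Real.sqrt 2 * Real.sqrt (c₀ * ((F.L : ℝ) ^ 3) ^ (K - n)) := Real.sqrt_mul (by norm_num) _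
  have hr : Real.sqrt (c₀ * ((F.L : ℝ) ^ 3) ^ (K - n)) * Real.sqrt (c₀ * ((F.L : ℝ) ^ 3) ^ (K - n)) = c₀ * ((F.L : ℝ) ^ 3) ^ (K - n) := Real.mul_self_sqrt hC1.le
  rw [hS, hM, hX, hs2]
  refine Eq.trans (b := am * ((5 / 4) * Real.sqrt 2) * Real.sqrt (25 / 8) * (Real.exp (3 * μ) * (8 * Real.sqrt (max 2 (16 / am)) ^ 2))
      * ((Real.sqrt (c₀ * ((F.L : ℝ) ^ 3) ^ (K - n)) * Real.sqrt (c₀ * ((F.L : ℝ) ^ 3) ^ (K - n))) * (((F.L : ℝ) ^ 3) ^ (K - n))⁻¹ / c₀)) (by ring) ?_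
  rw [hr]; field_simp

/-- **(P2) px12's `B₂`-TYPE UNIT AT THE PIN**: `√(3³∕(c₀ℓ³)·8)·(X·(8√M)²·(√(c₀(L^d)^{K−n})·1)) = √216·(X·(8√(max 2 (16∕am)))²)` — the `ℓ`-carrying leaves pair exactly.
[cite: Balaban1985BackgroundPropagators, Thm 3.1 (3.43) p.398] -/
theorem unitP2_pin (hc₀ : 0 < c₀) {am : ℝ} (ham : 0 < am) (μ : ℝ) :
    Real.sqrt (3 ^ 3 / (c₀ * ((F.L : ℝ) ^ (K - n)) ^ 3) * 8) * (Real.sqrt (8 * Real.exp (3 * min μ (1 / 4)) * Real.exp (6 * μ) * (2 * (1 + 1 / μ)) ^ 3) * ((8 * Real.sqrt (max 2 (16 * c₀ * ((F.L : ℝ) ^ (K - n)) ^ 3 / (am * (c₀ * ((F.L : ℝ) ^ 3) ^ (K - n))))) ^ 2) * (Real.sqrt (c₀ * ((((F.P K).L : ℝ) ^ (F.P K).d) ^ (K - n))) * 1))) = Real.sqrt 216 * (Real.sqrt (8 * Real.exp (3 * min μ (1 / 4)) * Real.exp (6 * μ) * (2 * (1 + 1 / μ)) ^ 3) * (8 *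 Real.sqrt (max 2 (16 / am)) ^ 2)) := by
  have hL : (0 : ℝ) < F.L := by have := F.hL.2; exact_mod_cast (by omega : 0 < F.L)
  have hPL : ((F.P K).L : ℝ) = (F.L : ℝ) := by norm_cast
  have hX : ((((F.P K).L : ℝ) ^ (F.P K).d) ^ (K - n)) = ((F.L : ℝ) ^ 3) ^ (K - n) := by rw [hPL, T3Family.P_d]
  have hM : 16 * c₀ * ((F.L : ℝ) ^ (K - n)) ^ 3 / (am * (c₀ * ((F.L : ℝ) ^ 3) ^ (K - n))) = 16 / am := by
    rw [← pow_mul, ← pow_mul, mul_comm (K - n) 3]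
    have h3' : (F.L : ℝ) ^ (3 * (K - n)) ≠ 0 := by positivity
    field_simp
  have hprod : 3 ^ 3 / (c₀ * ((F.L : ℝ) ^ (K - n)) ^ 3) * 8 * (c₀ * ((F.L : ℝ) ^ 3) ^ (K - n)) = 216 := by
    rw [← pow_mul, ← pow_mul, mul_comm (K - n) 3]
    have h3' : (F.L : ℝ) ^ (3 * (K - n)) ≠ 0 := by positivity
    field_simp
    ring
  have hCr : Real.sqrt (3 ^ 3 / (c₀ * ((F.L : ℝ) ^ (K - n)) ^ 3) * 8) * Real.sqrt (c₀ * ((F.L : ℝ) ^ 3) ^ (K - n)) = Real.sqrt 216 := by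
    rw [← Real.sqrt_mul (by positivity), hprod]
  rw [hM, hX]
  refine Eq.trans (b := (Real.sqrt (3 ^ 3 / (c₀ * ((F.L : ℝ) ^ (K - n)) ^ 3) * 8) * Real.sqrt (c₀ * ((F.L : ℝ) ^ 3) ^ (K - n)))
      * (Real.sqrt (8 * Real.exp (3 * min μ (1 / 4)) * Real.exp (6 * μ) * (2 * (1 + 1 / μ)) ^ 3) * (8 * Real.sqrt (max 2 (16 / am)) ^ 2))) (by ring) ?_
  rw [hCr]

end Pin

/-! ## §2 ★★★ hPcol at one member, letters discharged, member-free constant -/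

section Member

variable (F : T3Family) {n K : ℕ} (h : n ≤ K) {c₀ cB : ℝ} [Fact (0 < c₀)] [Fact (0 < cB)]
  {ε₀ : ℝ} (hε₀ : 0 < ε₀) (hε7 : 10 ^ 7 * (F.L : ℝ) ^ 3 * ε₀ ≤ 1)
  (U₀ : GaugeField (F.P K) 0 (Matrix.specialUnitaryGroup (Fin 2) ℂ)) (hreg : RegPr F n K ε₀ U₀)
  (Q'' : SiteL2K ℂ 3 (periodsT3 F K) c₀ W₂ →ₗ[ℂ] (Site (F.P K) (K - n) → Matrix (Fin 2) (Fin 2) ℂ))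
  (hseq : ∀ lam : Site (F.P K) 0 → Matrix (Fin 2) (Fin 2) ℂ, ∃ ns : (j : ℕ) → Site (F.P K) j → Matrix (Fin 2) (Fin 2) ℂ, ns 0 = lam ∧
      (∀ (j : ℕ) (y : Site (F.P K) (j + 1)), ns (j + 1) y = ns j (emb y) - meanCLM (Idx (F.P K)) (Matrix (Fin 2) (Fin 2) ℂ) fun i : Idx (F.P K) =>
        ns j (emb y) - ((holT (emlIterU j (bgUnits F K U₀)) (emb y) (stairWord i.2.1 (off i.1)) : (Matrix (Fin 2) (Fin 2) ℂ)ˣ) : Matrix (Fin 2) (Fin 2) ℂ) *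
          ns j (transl (emb y) (disp (stairWord i.2.1 (off i.1)))) * (((holT (emlIterU j (bgUnits F K U₀)) (emb y) (stairWord i.2.1 (off i.1)))⁻¹ : (Matrix (Fin 2) (Fin 2) ℂ)ˣ) : Matrix (Fin 2) (Fin 2) ℂ)) ∧
      ns (K - n) = Q'' (toL2S F K c₀ lam))
  (hRS : RS F n K h c₀ cB U₀ = projR (covLapSite F n K c₀ U₀) Q'')
  (hker : LinearMap.ker Q'' ≤ NS F n K h c₀ cB U₀)

include hε₀ hε7 hreg hseq hRS hker in
-- HEARTBEAT rule (README): measured on the farm — the 4-kchar closed statement + three letter instantiations FAIL at a decl-local 100000 (`whnf`), pass at the default;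
-- decl-local insurance as ✓p764315 `kernelRow349_pin` ∕ ✓p765417, never file-global.
set_option maxHeartbeats 400000 in
/-- ★★★ **hPcol AT ONE MEMBER — LETTERS DISCHARGED, MEMBER-FREE CONSTANT.**  PIN-A ✓`hPcol_pin` with `hcol` ⟸ V5b ✓`hcol_of_massiveColumn_decay`, `hGsup` ⟸ ✓`hGsup_of_regPr`, `hT1` ⟸ ✓`hT1_of_regPr`, all
at the pinned weight `c₁ := c₀·(L³)^{K−n}` under the column window of slope `μ(am) = 1∕(10√(max 2 (16∕am))√(27 + 2025am∕8))` (✓`window_delta`, ✓`window_win`), and the three constants rewritten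
by the leaf identities (✓`unitA_pin`, ✓`unitU1_pin`, ✓`unitU3_pin`, `unitP1_pin`, `unitP3_pin`, `unitP2_pin`): the EX row `hPcol`'s display at one ROOMY member with `p139⋆(am, ε₀)` —
no `K`, `n`, `c₀`, `c₁`, `|T³|`. [cite: Balaban1985Variational, (138)–(139) p.299; Balaban1985BackgroundPropagators, Thm 3.1 (3.42)∕(3.46) pp.397–398, (3.49) p.399; Balaban1988RG2Cluster, (2.7) p.13] -/
theorem hPcol_member (hnK : n < K) {am : ℝ} (ham : 0 < am) [hc₁ : Fact (0 < c₀ * ((F.L : ℝ) ^ 3) ^ (K - n))]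
    (ι : (Site (F.P K) (K - n) → Matrix (Fin 2) (Fin 2) ℂ) →ₗ[ℂ] SiteL2K ℂ 3 (periodsT3 F n) (c₀ * ((F.L : ℝ) ^ 3) ^ (K - n)) W₂)
    (hι : ∀ c, ι c = toL2S F n (c₀ * ((F.L : ℝ) ^ 3) ^ (K - n)) (fun z => c (siteShift (sites_eq F n K h) z)))
    (T : SiteL2K ℂ 3 (periodsT3 F n) (c₀ * ((F.L : ℝ) ^ 3) ^ (K - n)) W₂ →ₗ[ℂ] SiteL2K ℂ 3 (periodsT3 F K) c₀ W₂)
    (hT : ∀ (l : SiteL2K ℂ 3 (periodsT3 F K) c₀ W₂) (f : SiteL2K ℂ 3 (periodsT3 F n) (c₀ * ((F.L : ℝ) ^ 3) ^ (K - n)) W₂), ⟪ι (Q'' l), f⟫_ℂ = ⟪l, T f⟫_ℂ)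
    (G : SiteL2K ℂ 3 (periodsT3 F K) c₀ W₂ →ₗ[ℂ] SiteL2K ℂ 3 (periodsT3 F K) c₀ W₂)
    (hAG : ∀ f, covLapSite F n K c₀ U₀ (G f) + (am : ℂ) • T (ι (Q'' (G f))) = f)
    (hGA : ∀ u, G (covLapSite F n K c₀ U₀ u + (am : ℂ) • T (ι (Q'' u))) = u)
    {a' : ℝ} (ha' : 0 ≤ a')
    (hroom : 2 * (12 * F.L ^ (K - n) + 5) ≤ (F.P K).sitesPerDir 0)
    (hsmall : exists_curved_localGradient.choose * ((48 * ε₀) * (6 * Real.sqrt 2 * Real.sqrt 10 + 6 * Real.sqrt 2)) ≤ 1 / 2)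
    (bd : PBond (F.P K) 0) (E : Matrix (Fin 2) (Fin 2) ℂ) :
    ∑ x : Site (F.P K) 0, ‖(toL2S F K c₀).symm (GprimeP F n K h c₀ cB a' U₀ (RS F n K h c₀ cB U₀ (DstarL2 F n K c₀ U₀ (toL2 F K c₀ (Pi.single bd E))))) x‖
      ≤ 4 * Real.sqrt 2 * ((2 * (exists_curved_localGradient.choose * ((((14 * (8 * Real.exp (3 * min (1 / (10 * Real.sqrt (max 2 (16 / am)) * Real.sqrt (27 + 2025 / 8 * am))) (1 / 4)) * (1 + Real.exp (3 * (1 / (10 * Real.sqrt (max 2 (16 / am)) * Real.sqrt (27 + 2025 / 8 * am)))) * ((am * ((5 / 4) * Real.sqrt 2) * Real.sqrt (25 / 8) * (8 * Real.sqrt (max 2 (16 / am)) ^ 2)))))) + ((Real.sqrt 216 * (Real.sqrt (8 * Real.exp (3 * min (1 / (10 * Real.sqrt (max 2 (16 / am)) * Real.sqrt (27 + 2025 / 8 * am))) (1 / 4)) * Real.exp (6 * (1 / (10 * Real.sqrt (max 2 (16 / am)) * Real.sqrt (27 + 2025 / 8 * am)))) * (2 * (1 + 1 / (1 / (10 * Real.sqrt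 (max 2 (16 / am)) * Real.sqrt (27 + 2025 / 8 * am))))) ^ 3) * (8 * Real.sqrt (max 2 (16 / am)) ^ 2))))) * (2 * (1 + 1 / (min (1 / (10 * Real.sqrt (max 2 (16 / am)) * Real.sqrt (27 + 2025 / 8 * am))) (1 / 4) / 2))) ^ 3) * (2 + 2 * Real.sqrt 2 * (4 * ε₀ * (3 + 2457 * norm_bgOfCfg_axialT_sub_le.choose)) + (24 * Real.sqrt 10 + 48) * (48 * ε₀) ^ 2) + (((am * ((5 / 4) * Real.sqrt 2) * Real.sqrt (25 / 8) * (Real.exp (3 * (1 / (10 * Real.sqrt (max 2 (16 / am)) * Real.sqrt (27 + 2025 / 8 * am)))) * (8 * Real.sqrt (max 2 (16 / am)) ^ 2))) * (2 * (1 + 1 / (1 / (10 * Real.sqrt (max 2 (16 / am)) * Real.sqrt (27 + 2025 / 8 * am))))) ^ 3) + 1)) + 2 * Real.sqrt 2 * (48 * ε₀) * (((14 * (8 * Real.exp (3 * min (1 / (10 * Real.sqrt (max 2 (16 / am)) * Real.sqrt (27 + 2025 / 8 * am))) (1 / 4)) * (1 + Real.exp (3 * (1 / (10 * Real.sqrt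 (max 2 (16 / am)) * Real.sqrt (27 + 2025 / 8 * am)))) * ((am * ((5 / 4) * Real.sqrt 2) * Real.sqrt (25 / 8) * (8 * Real.sqrt (max 2 (16 / am)) ^ 2)))))) + ((Real.sqrt 216 * (Real.sqrt (8 * Real.exp (3 * min (1 / (10 * Real.sqrt (max 2 (16 / am)) * Real.sqrt (27 + 2025 / 8 * am))) (1 / 4)) * Real.exp (6 * (1 / (10 * Real.sqrt (max 2 (16 / am)) * Real.sqrt (27 + 2025 / 8 * am)))) * (2 * (1 + 1 / (1 / (10 * Real.sqrt (max 2 (16 / am)) * Real.sqrt (27 + 2025 / 8 * am))))) ^ 3) * (8 * Real.sqrt (max 2 (16 / am)) ^ 2))))) * (2 * (1 + 1 / (min (1 / (10 * Real.sqrt (max 2 (16 / am)) * Real.sqrt (27 + 2025 / 8 * am))) (1 / 4) / 2))) ^ 3))) * (5 * (1 + (10 * (18 / (2 / ((1 + 25 / 8) * (600 * (27 / 4 : ℝ) ^ 6 + am))) ^ 2) * (4 * (2 * (1 + 1 / (min ((1 / (10 * Real.sqrt (max 2 (16 / am)) * Real.sqrt (27 + 2025 / 8 * am))) / 2) ((2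 / ((1 + 25 / 8) * (600 * (27 / 4 : ℝ) ^ 6 + am))) / (3 * (Real.sqrt (max 2 (16 / am)) * (2 + Real.sqrt (max 2 (16 / am))) * (3 * Real.sqrt 3 + 27 + 9 * Real.sqrt am * Real.sqrt (25 / 8) + 81 * am * (25 / 8)) * (8 * Real.sqrt (max 2 (16 / am)) + 8 * Real.sqrt (max 2 (16 / am)) ^ 2) * (10 * Real.sqrt (25 / 8)) + 9 * (max 2 (16 / am)) * Real.sqrt (25 / 8))))))) ^ 3) * (((14 * (8 * Real.exp (3 * min (1 / (10 * Real.sqrt (max 2 (16 / am)) * Real.sqrt (27 + 2025 / 8 * am))) (1 / 4)) * (((5 / 2 : ℝ)) + Real.exp (3 * (1 / (10 * Real.sqrt (max 2 (16 / am)) * Real.sqrt (27 + 2025 / 8 * am)))) * ((am * (5 / 2) * (25 / 8) * (8 * max 2 (16 / am))))))) + ((Real.sqrt 432 * (Real.sqrt (8 * Real.exp (3 * min (1 / (10 * Real.sqrt (max 2 (16 / am)) * Real.sqrt (27 + 2025 / 8 * am))) (1 / 4)) * Real.exp (6 * (1 / (10 * Real.sqrt (max 2 (16 / am)) * Real.sqrt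 (27 + 2025 / 8 * am)))) * (2 * (1 + 1 / (1 / (10 * Real.sqrt (max 2 (16 / am)) * Real.sqrt (27 + 2025 / 8 * am))))) ^ 3) * ((8 * max 2 (16 / am)) * Real.sqrt (25 / 8)))))) * (2 * (1 + 1 / (min (1 / (10 * Real.sqrt (max 2 (16 / am)) * Real.sqrt (27 + 2025 / 8 * am))) (1 / 4) / 2))) ^ 3)) * (((14 * (8 * Real.exp (3 * min (1 / (10 * Real.sqrt (max 2 (16 / am)) * Real.sqrt (27 + 2025 / 8 * am))) (1 / 4)) * (1 + Real.exp (3 * (1 / (10 * Real.sqrt (max 2 (16 / am)) * Real.sqrt (27 + 2025 / 8 * am)))) * ((am * ((5 / 4) * Real.sqrt 2) * Real.sqrt (25 / 8) * (8 * Real.sqrt (max 2 (16 / am)) ^ 2)))))) + ((Real.sqrt 216 * (Real.sqrt (8 * Real.exp (3 * min (1 / (10 * Real.sqrt (max 2 (16 / am)) * Real.sqrt (27 + 2025 / 8 * am))) (1 / 4)) * Real.exp (6 * (1 / (10 * Real.sqrt (max 2 (16 / am)) * Real.sqrt (27 + 2025 / 8 * am)))) * (2 * (1 + 1 / (1 /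 (10 * Real.sqrt (max 2 (16 / am)) * Real.sqrt (27 + 2025 / 8 * am))))) ^ 3) * (8 * Real.sqrt (max 2 (16 / am)) ^ 2))))) * (2 * (1 + 1 / (min (1 / (10 * Real.sqrt (max 2 (16 / am)) * Real.sqrt (27 + 2025 / 8 * am))) (1 / 4) / 2))) ^ 3)))) * ‖E‖ := by
  have hc₀ : 0 < c₀ := Fact.out
  have hc₁ : 0 < c₀ * ((F.L : ℝ) ^ 3) ^ (K - n) := hc₁.out
  have hL1 : (1 : ℝ) < F.L := by exact_mod_cast F.hL.2
  have hL0 : (0 : ℝ) < F.L := by linarith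
  have hLP := (F.P K).L_pos
  -- the pin's raw letters
  have hsx : (25 / 8) * (c₀ * ((F.L : ℝ) ^ 3) ^ (K - n) * ((((F.P K).L : ℝ) ^ (F.P K).d) ^ (K - n))⁻¹ / c₀) = 25 / 8 := by
    rw [show ((F.P K).L : ℝ) = (F.L : ℝ) from rfl, T3Family.P_d]; field_simp
  have hMraw : 16 * c₀ * ((F.L : ℝ) ^ (K - n)) ^ 3 / (am * (c₀ * ((F.L : ℝ) ^ 3) ^ (K - n))) = 16 / am := by
    rw [← pow_mul, ← pow_mul, Nat.mul_comm]; field_simp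
  have hM : max 2 (16 * c₀ * ((F.L : ℝ) ^ (K - n)) ^ 3 / (am * (c₀ * ((F.L : ℝ) ^ 3) ^ (K - n)))) = max 2 (16 / am) := by rw [hMraw]
  have hη : 0 < eta F n K := eta_pos F n K
  have hη1 : eta F n K ≤ 1 := by
    show ((F.L : ℝ)⁻¹) ^ (K - n) ≤ 1
    exact pow_le_one₀ (inv_nonneg.2 hL0.le) (inv_le_one_of_one_le₀ hL1.le)
  -- the column window at slope `μ(am)` (W1: `window_delta` for `3μ ≤ 1`, `window_win` with EQUALITY at `μ(am)`)
  have hM'2 : (2 : ℝ) ≤ max 2 (16 / am) := le_max_left _ _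
  have hcδ1 : (1 : ℝ) ≤ 27 + 2025 / 8 * am := by linarith [ham.le]
  have hsM1 : 1 ≤ Real.sqrt (max 2 (16 / am)) := Real.one_le_sqrt.2 (by linarith)
  have hsc1 : 1 ≤ Real.sqrt (27 + 2025 / 8 * am) := Real.one_le_sqrt.2 hcδ1
  have hμ0 : 0 < (1 / (10 * Real.sqrt (max 2 (16 / am)) * Real.sqrt (27 + 2025 / 8 * am))) := by positivity
  have hμ10 : 10 * (1 / (10 * Real.sqrt (max 2 (16 / am)) * Real.sqrt (27 + 2025 / 8 * am))) ≤ 1 := by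
    have h1 : (1 : ℝ) ≤ Real.sqrt (max 2 (16 / am)) * Real.sqrt (27 + 2025 / 8 * am) := one_le_mul_of_one_le_of_one_le hsM1 hsc1
    rw [show 10 * (1 / (10 * Real.sqrt (max 2 (16 / am)) * Real.sqrt (27 + 2025 / 8 * am))) = 1 / (Real.sqrt (max 2 (16 / am)) * Real.sqrt (27 + 2025 / 8 * am)) by field_simp]
    rw [div_le_one (by positivity)]
    exact h1
  have hμ3 : 3 * (1 / (10 * Real.sqrt (max 2 (16 / am)) * Real.sqrt (27 + 2025 / 8 * am))) ≤ 1 := by linarith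
  have hδ := window_delta (a := am) (sx := ((25 / 8) * (c₀ * ((F.L : ℝ) ^ 3) ^ (K - n) * ((((F.P K).L : ℝ) ^ (F.P K).d) ^ (K - n))⁻¹ / c₀))) (η := eta F n K) ham hsx hη hη1 hμ0.le hμ3
  have hwin := window_win ham hM
  -- the three letters at the pin
  have hcol := hcol_of_massiveColumn_decay F h hε₀ hε7 U₀ hreg Q'' hseq ι hι T hT ham G hAG hμ0 (δ₂ := Real.sqrt (27 + 2025 / 8 * am) * (1 / (10 * Real.sqrt (max 2 (16 / am)) * Real.sqrt (27 + 2025 / 8 * am)))) (by positivity) hδ hwin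
  have hGsup := hGsup_of_regPr F h hε₀ hε7 U₀ hreg Q'' hseq ι hι T hT ham G hAG hμ0 (δ₁ := Real.sqrt (27 + 2025 / 8 * am) * (1 / (10 * Real.sqrt (max 2 (16 / am)) * Real.sqrt (27 + 2025 / 8 * am)))) (by positivity) hδ hwin
  have hT1 := hT1_of_regPr F h hε₀ hε7 U₀ hreg Q'' hseq ι hι T hT ham G hAG hμ0 (δ₁ := Real.sqrt (27 + 2025 / 8 * am) * (1 / (10 * Real.sqrt (max 2 (16 / am)) * Real.sqrt (27 + 2025 / 8 * am)))) (by positivity) hδ hwin hroom hsmall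
  have hκ : 0 < min (1 / (10 * Real.sqrt (max 2 (16 / am)) * Real.sqrt (27 + 2025 / 8 * am))) (1 / 4) / 2 := by positivity
  have hCpt : 0 ≤ (14 * (8 * Real.exp (3 * min (1 / (10 * Real.sqrt (max 2 (16 / am)) * Real.sqrt (27 + 2025 / 8 * am))) (1 / 4)) * ((5 / 4) * Real.sqrt (2 * (c₀ * ((F.L : ℝ) ^ 3) ^ (K - n))) * ((((F.P K).L : ℝ) ^ (F.P K).d) ^ (K - n))⁻¹ / c₀ * Real.sqrt (2 * (c₀ * ((F.L : ℝ) ^ 3) ^ (K - n))) + Real.exp (3 * (1 / (10 * Real.sqrt (max 2 (16 / am)) * Real.sqrt (27 + 2025 / 8 * am)))) * ((am * ((5 / 4) * Real.sqrt (2 * (c₀ * ((F.L : ℝ) ^ 3) ^ (K - n))) * ((((F.P K).L : ℝ) ^ (F.P K).d) ^ (K - n))⁻¹ / c₀) * Real.sqrt ((25 / 8) * ((c₀ * ((F.L : ℝ) ^ 3) ^ (K - n)) * ((((F.P K).L : ℝ) ^ (F.P K).d) ^ (K - n))⁻¹ / c₀))) * ((8 * Real.sqrt (max 2 (16 * c₀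 * ((F.L : ℝ) ^ (K - n)) ^ 3 / (am * (c₀ * ((F.L : ℝ) ^ 3) ^ (K - n))))) ^ 2) * (Real.sqrt ((25 / 8) * ((c₀ * ((F.L : ℝ) ^ 3) ^ (K - n)) * ((((F.P K).L : ℝ) ^ (F.P K).d) ^ (K - n))⁻¹ / c₀)) * Real.sqrt (2 * (c₀ * ((F.L : ℝ) ^ 3) ^ (K - n))))))))) + (Real.sqrt (3 ^ 3 / (c₀ * ((F.L : ℝ) ^ (K - n)) ^ 3) * 8) * (Real.sqrt (8 * Real.exp (3 * min (1 / (10 * Real.sqrt (max 2 (16 / am)) * Real.sqrt (27 + 2025 / 8 * am))) (1 / 4)) * Real.exp (6 * (1 / (10 * Real.sqrt (max 2 (16 / am)) * Real.sqrt (27 + 2025 / 8 * am)))) * (2 * (1 + 1 / (1 / (10 * Real.sqrt (max 2 (16 / am)) * Real.sqrt (27 + 2025 / 8 * am))))) ^ 3) * ((8 * Real.sqrt (max 2 (16 * c₀ * ((F.L : ℝ) ^ (K - n)) ^ 3 / (am * (c₀ * ((F.L : ℝ) ^ 3) ^ (K - n))))) ^ 2) * (Real.sqrt ((25 / 8) *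 ((c₀ * ((F.L : ℝ) ^ 3) ^ (K - n)) * ((((F.P K).L : ℝ) ^ (F.P K).d) ^ (K - n))⁻¹ / c₀)) * Real.sqrt (2 * (c₀ * ((F.L : ℝ) ^ 3) ^ (K - n))))))) := by positivity
  -- PIN-A at these letters
  have hfin := hPcol_pin F h hε₀ hε7 U₀ hreg Q'' hseq hRS hker hnK ham ι hι T hT G hAG hGA ha' hκ hCpt hcol hGsup hT1 bd E
  -- the leaves
  rw [unitU3_pin F hc₀ ham, unitU1_pin F hc₀ ham, unitA_pin F hc₀, unitP1_pin F hc₀ ham, unitP3_pin F hc₀ ham, unitP2_pin F hc₀ ham] at hfin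
  exact hfin

include hε₀ hreg in
/-- ★★★ **hPcol AT ONE ROOMY MEMBER, FAMILIES OF RECORD DISCHARGED** — §2 with `Q″ hseq hker ← exists_intertwiner_of_regPr`, `hRS ← RS_eq_projR_of_lift (hLift)`, `ι` by `rfl`, `T := (ι∘Q″)†`,
`G ← exists_massive_inverse` (mass `am`); displayed: `RegPr F n K ε₀ U₀` with `10¹²L³ε₀ ≤ 1`, the face's Lift antecedent, `0 ≤ a′`, `hroom`, `hsmall`.  Constant = §2's `p139⋆(am, ε₀)`.
[cite: Balaban1985Variational, (138)–(139) p.299; Balaban1985BackgroundPropagators, (3.20)–(3.25) p.394, Thm 3.1 (3.42) p.397, (3.114)–(3.122) pp.418–420] -/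
theorem hPcol_member_of_lift (hnK : n < K) (hε12 : 10 ^ 12 * (F.L : ℝ) ^ 3 * ε₀ ≤ 1) {am : ℝ} (ham : 0 < am)
    (hLift : ∀ cf : Site (F.P K) (K - n) → Matrix (Fin 2) (Fin 2) ℂ,
      (∀ e : PBond (F.P K) (K - n), cf e.src = ((emlIterU (K - n) (bgUnits F K U₀) e : (Matrix (Fin 2) (Fin 2) ℂ)ˣ) : Matrix (Fin 2) (Fin 2) ℂ) * cf e.tgt *
        (((emlIterU (K - n) (bgUnits F K U₀) e)⁻¹ : (Matrix (Fin 2) (Fin 2) ℂ)ˣ) : Matrix (Fin 2) (Fin 2) ℂ)) →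
      ∃ l₀ : Site (F.P K) 0 → Matrix (Fin 2) (Fin 2) ℂ,
        (∀ b : PBond (F.P K) 0, l₀ b.src = ((bgUnits F K U₀ b : (Matrix (Fin 2) (Fin 2) ℂ)ˣ) : Matrix (Fin 2) (Fin 2) ℂ) * l₀ b.tgt * (((bgUnits F K U₀ b)⁻¹ : (Matrix (Fin 2) (Fin 2) ℂ)ˣ) : Matrix (Fin 2) (Fin 2) ℂ)) ∧
        ∀ y : Site (F.P K) (K - n), l₀ (embIter (K - n) y) = cf y)
    {a' : ℝ} (ha' : 0 ≤ a')
    (hroom : 2 * (12 * F.L ^ (K - n) + 5) ≤ (F.P K).sitesPerDir 0)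
    (hsmall : exists_curved_localGradient.choose * ((48 * ε₀) * (6 * Real.sqrt 2 * Real.sqrt 10 + 6 * Real.sqrt 2)) ≤ 1 / 2)
    (bd : PBond (F.P K) 0) (E : Matrix (Fin 2) (Fin 2) ℂ) :
    ∑ x : Site (F.P K) 0, ‖(toL2S F K c₀).symm (GprimeP F n K h c₀ cB a' U₀ (RS F n K h c₀ cB U₀ (DstarL2 F n K c₀ U₀ (toL2 F K c₀ (Pi.single bd E))))) x‖
      ≤ 4 * Real.sqrt 2 * ((2 * (exists_curved_localGradient.choose * ((((14 * (8 * Real.exp (3 * min (1 / (10 * Real.sqrt (max 2 (16 / am)) * Real.sqrt (27 + 2025 / 8 * am))) (1 / 4)) * (1 + Real.exp (3 * (1 / (10 * Real.sqrt (max 2 (16 / am)) * Real.sqrt (27 + 2025 / 8 * am)))) * ((am * ((5 / 4) * Real.sqrt 2) * Real.sqrt (25 / 8) * (8 * Real.sqrt (max 2 (16 / am)) ^ 2)))))) + ((Real.sqrt 216 * (Real.sqrt (8 * Real.exp (3 * min (1 / (10 * Real.sqrt (max 2 (16 / am)) * Real.sqrt (27 + 2025 / 8 * am))) (1 / 4))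 * Real.exp (6 * (1 / (10 * Real.sqrt (max 2 (16 / am)) * Real.sqrt (27 + 2025 / 8 * am)))) * (2 * (1 + 1 / (1 / (10 * Real.sqrt (max 2 (16 / am)) * Real.sqrt (27 + 2025 / 8 * am))))) ^ 3) * (8 * Real.sqrt (max 2 (16 / am)) ^ 2))))) * (2 * (1 + 1 / (min (1 / (10 * Real.sqrt (max 2 (16 / am)) * Real.sqrt (27 + 2025 / 8 * am))) (1 / 4) / 2))) ^ 3) * (2 + 2 * Real.sqrt 2 * (4 * ε₀ * (3 + 2457 * norm_bgOfCfg_axialT_sub_le.choose)) + (24 * Real.sqrt 10 + 48) * (48 * ε₀) ^ 2) + (((am * ((5 / 4) * Real.sqrt 2) * Real.sqrt (25 / 8) * (Real.exp (3 * (1 / (10 * Real.sqrt (max 2 (16 / am)) * Real.sqrt (27 + 2025 / 8 * am)))) * (8 * Real.sqrt (max 2 (16 / am)) ^ 2))) * (2 * (1 + 1 / (1 / (10 * Real.sqrt (max 2 (16 / am)) * Real.sqrt (27 + 2025 / 8 * am))))) ^ 3) + 1)) + 2 * Real.sqrt 2 * (48 * ε₀) * (((14 * (8 * Real.exp (3 *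 min (1 / (10 * Real.sqrt (max 2 (16 / am)) * Real.sqrt (27 + 2025 / 8 * am))) (1 / 4)) * (1 + Real.exp (3 * (1 / (10 * Real.sqrt (max 2 (16 / am)) * Real.sqrt (27 + 2025 / 8 * am)))) * ((am * ((5 / 4) * Real.sqrt 2) * Real.sqrt (25 / 8) * (8 * Real.sqrt (max 2 (16 / am)) ^ 2)))))) + ((Real.sqrt 216 * (Real.sqrt (8 * Real.exp (3 * min (1 / (10 * Real.sqrt (max 2 (16 / am)) * Real.sqrt (27 + 2025 / 8 * am))) (1 / 4)) * Real.exp (6 * (1 / (10 * Real.sqrt (max 2 (16 / am)) * Real.sqrt (27 + 2025 / 8 * am)))) * (2 * (1 + 1 / (1 / (10 * Real.sqrt (max 2 (16 / am)) * Real.sqrt (27 + 2025 / 8 * am))))) ^ 3) * (8 * Real.sqrt (max 2 (16 / am)) ^ 2))))) * (2 * (1 + 1 / (min (1 / (10 * Real.sqrt (max 2 (16 / am)) * Real.sqrt (27 + 2025 / 8 * am))) (1 / 4) / 2))) ^ 3))) * (5 * (1 + (10 * (18 / (2 / ((1 + 25 / 8) * (600 * (27 / 4 : ℝ) ^ 6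 + am))) ^ 2) * (4 * (2 * (1 + 1 / (min ((1 / (10 * Real.sqrt (max 2 (16 / am)) * Real.sqrt (27 + 2025 / 8 * am))) / 2) ((2 / ((1 + 25 / 8) * (600 * (27 / 4 : ℝ) ^ 6 + am))) / (3 * (Real.sqrt (max 2 (16 / am)) * (2 + Real.sqrt (max 2 (16 / am))) * (3 * Real.sqrt 3 + 27 + 9 * Real.sqrt am * Real.sqrt (25 / 8) + 81 * am * (25 / 8)) * (8 * Real.sqrt (max 2 (16 / am)) + 8 * Real.sqrt (max 2 (16 / am)) ^ 2) * (10 * Real.sqrt (25 / 8)) + 9 * (max 2 (16 / am)) * Real.sqrt (25 / 8))))))) ^ 3) * (((14 * (8 * Real.exp (3 * min (1 / (10 * Real.sqrt (max 2 (16 / am)) * Real.sqrt (27 + 2025 / 8 * am))) (1 / 4)) * (((5 / 2 : ℝ)) + Real.exp (3 * (1 / (10 * Real.sqrt (max 2 (16 / am)) * Real.sqrt (27 + 2025 / 8 * am)))) * ((am * (5 / 2) * (25 / 8) * (8 * max 2 (16 / am))))))) + ((Real.sqrt 432 * (Real.sqrt (8 * Real.exp (3 * min (1 / (10 * Real.sqrt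 (max 2 (16 / am)) * Real.sqrt (27 + 2025 / 8 * am))) (1 / 4)) * Real.exp (6 * (1 / (10 * Real.sqrt (max 2 (16 / am)) * Real.sqrt (27 + 2025 / 8 * am)))) * (2 * (1 + 1 / (1 / (10 * Real.sqrt (max 2 (16 / am)) * Real.sqrt (27 + 2025 / 8 * am))))) ^ 3) * ((8 * max 2 (16 / am)) * Real.sqrt (25 / 8)))))) * (2 * (1 + 1 / (min (1 / (10 * Real.sqrt (max 2 (16 / am)) * Real.sqrt (27 + 2025 / 8 * am))) (1 / 4) / 2))) ^ 3)) * (((14 * (8 * Real.exp (3 * min (1 / (10 * Real.sqrt (max 2 (16 / am)) * Real.sqrt (27 + 2025 / 8 * am))) (1 / 4)) * (1 + Real.exp (3 * (1 / (10 * Real.sqrt (max 2 (16 / am)) * Real.sqrt (27 + 2025 / 8 * am)))) * ((am * ((5 / 4) * Real.sqrt 2) * Real.sqrt (25 / 8) * (8 * Real.sqrt (max 2 (16 / am)) ^ 2)))))) + ((Real.sqrt 216 * (Real.sqrt (8 * Real.exp (3 * min (1 / (10 * Real.sqrt (max 2 (16 / am)) * Real.sqrt (27 + 2025 / 8 * am)))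 (1 / 4)) * Real.exp (6 * (1 / (10 * Real.sqrt (max 2 (16 / am)) * Real.sqrt (27 + 2025 / 8 * am)))) * (2 * (1 + 1 / (1 / (10 * Real.sqrt (max 2 (16 / am)) * Real.sqrt (27 + 2025 / 8 * am))))) ^ 3) * (8 * Real.sqrt (max 2 (16 / am)) ^ 2))))) * (2 * (1 + 1 / (min (1 / (10 * Real.sqrt (max 2 (16 / am)) * Real.sqrt (27 + 2025 / 8 * am))) (1 / 4) / 2))) ^ 3)))) * ‖E‖ := by
  have hc₀ : 0 < c₀ := Fact.out
  have hL : (0 : ℝ) < F.L := by have := F.hL.2; exact_mod_cast (by omega : 0 < F.L)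
  have hε7 : 10 ^ 7 * (F.L : ℝ) ^ 3 * ε₀ ≤ 1 := by
    have h1 : (10 : ℝ) ^ 7 * (F.L : ℝ) ^ 3 * ε₀ ≤ 10 ^ 12 * (F.L : ℝ) ^ 3 * ε₀ := by
      have : 0 ≤ (F.L : ℝ) ^ 3 * ε₀ := by positivity
      nlinarith
    exact h1.trans hε12
  -- the `Q″` of record, its ∃-form top-mean clause and `ker Q″ ≤ N_S`; the Lift identity `R_S = projR Δ Q″`
  obtain ⟨Q'', D', -, -, htop, hseq, hker⟩ := exists_intertwiner_of_regPr F h (c₀ := c₀) cB hε₀ hε12 U₀ hreg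
  have hRS := RS_eq_projR_of_lift F h cB hε₀ hε12 U₀ hreg hLift Q'' htop hker
  -- the LOD data at the pinned weight: `ι` by `rfl`, `T := (ι∘Q″)†`, `G ← exists_massive_inverse`
  haveI : Fact (0 < c₀ * ((F.L : ℝ) ^ 3) ^ (K - n)) := ⟨by positivity⟩
  obtain ⟨ι', hι'⟩ : ∃ ι' : (Site (F.P K) (K - n) → Matrix (Fin 2) (Fin 2) ℂ) →ₗ[ℂ] SiteL2K ℂ 3 (periodsT3 F n) (c₀ * ((F.L : ℝ) ^ 3) ^ (K - n)) W₂,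
      ∀ c, ι' c = toL2S F n (c₀ * ((F.L : ℝ) ^ 3) ^ (K - n)) (fun z => c (siteShift (sites_eq F n K h) z)) :=
    ⟨(toL2S F n (c₀ * ((F.L : ℝ) ^ 3) ^ (K - n))).toLinearMap ∘ₗ LinearMap.funLeft ℂ (Matrix (Fin 2) (Fin 2) ℂ) (siteShift (sites_eq F n K h)), fun c => rfl⟩
  obtain ⟨T', hT'⟩ : ∃ T' : SiteL2K ℂ 3 (periodsT3 F n) (c₀ * ((F.L : ℝ) ^ 3) ^ (K - n)) W₂ →ₗ[ℂ] SiteL2K ℂ 3 (periodsT3 F K) c₀ W₂,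
      ∀ (l : SiteL2K ℂ 3 (periodsT3 F K) c₀ W₂) (f : SiteL2K ℂ 3 (periodsT3 F n) (c₀ * ((F.L : ℝ) ^ 3) ^ (K - n)) W₂), ⟪ι' (Q'' l), f⟫_ℂ = ⟪l, T' f⟫_ℂ :=
    ⟨LinearMap.adjoint (ι' ∘ₗ Q''), fun l f => by rw [LinearMap.adjoint_inner_right, LinearMap.comp_apply]⟩
  obtain ⟨G', hAG', hGA', -⟩ := exists_massive_inverse F h hε₀ hε7 U₀ hreg Q'' hseq ι' hι' T' hT' ham
  exact hPcol_member F h hε₀ hε7 U₀ hreg Q'' hseq hRS hker hnK ham ι' hι' T' hT' G' hAG' hGA' ha' hroom hsmall bd E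

end Member

end Summit.QuantumFields.YangMills.Theorems.Prop7PcolMember

end
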